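import Mathlib
import HarnessLib
import Literature.Geometry.DiscreteGeometry.LayerShellPatterns
import Summits.AtomisticToContinuum.Crystallization.Theorems.BrittleRungDescentSoftLayerPropagationPatterns

/-!
# The HCP pattern against a cuboctahedron sharing a vertex star: mirror plane and far triple

Route `BrittleRungDescent`, support item `SoftLayerPropagation` (stmt-AtomisticToContinuum-9210),
helper file (η = 0, vocabulary of `FejesTothKissingTwelve.lean` / `KissingRigidity.lean`; uses
`…SoftLayerPropagationPatterns.lean`).  `hcp_shell_far_triple`: an HCP-arranged shell `T` that
contains a vertex `t` of a known cuboctahedron `F` together with the four `F`-neighbours of `t` has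
`t` as a polar vertex, and every point of `T` is a point of `F` or lies at level `−𝗁` against the
unit normal `n` of the mirror plane of `T` on the side of `t` (`⟪t, n⟫ = 𝗁`) — the far triple.
Ingredients: the integer tables (`decide`), the mirror symmetry of `hcpTab` in `x + y + z = 0`
(`Submodule.reflection`), and `eq_of_isArrangedIn_fcc_of_triangle`.  All elementary ([folklore]).
-/

noncomputable section

namespace Summit.AtomisticToContinuum.Crystallization.Theorems

open Literature.Geometry.DiscreteGeometry Literature.MathematicalPhysics.StatisticalMechanics
open RealInnerProductSpace

/-! ### Table facts (`decide`) -/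

/-- Levels of `hcpTab`: `0` (hexagon, `i < 6`), `6` (upper triangle, `i < 9`), `−6`. [folklore] -/
theorem hcpTab_level : ∀ i : Fin 12,
    dotInt (hcpTab i) ![1, 1, 1] = if i.val < 6 then 0 else if i.val < 9 then 6 else -6 := by
  decide

/-- Levels of the cuboctahedron table are `0, 2, −2`. [folklore] -/
theorem fccTab_level : ∀ j : Fin 12,
    dotInt (fccTab j) ![1, 1, 1] = 0 ∨ dotInt (fccTab j) ![1, 1, 1] = 2 ∨ dotInt (fccTab j) ![1, 1, 1] = -2 := by
  decide

/-- The nine non-negative-level points of `hcpTab` are `3 · fccTab` points. [folklore] -/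
theorem hcpTab_eq_three_smul : ∀ i : Fin 12, i.val < 9 → ∃ j : Fin 12, hcpTab i = (3 : ℤ) • fccTab j := by
  decide

/-- An upper-triangle point of `hcpTab` is `3 tⱼ` with `tⱼ` of level `2`. [folklore] -/
theorem hcpTab_top_eq_three_smul : ∀ i : Fin 12, 6 ≤ i.val → i.val < 9 →
    ∃ j : Fin 12, dotInt (fccTab j) ![1, 1, 1] = 2 ∧ hcpTab i = (3 : ℤ) • fccTab j := by
  decide

/-- The neighbours of a level-`2` vertex of the cuboctahedron are `hcpTab` points (scaled). [folklore] -/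
theorem fccTab_adj_top : ∀ j j' : Fin 12, dotInt (fccTab j) ![1, 1, 1] = 2 → fccAdj j' j →
    ∃ i : Fin 12, hcpTab i = (3 : ℤ) • fccTab j' := by
  decide

/-- Every vertex of the cuboctahedron lies in a contact triangle. [folklore] -/
theorem fccTab_exists_triangle : ∀ j : Fin 12, ∃ j₂ j₃ : Fin 12, fccAdj j j₂ ∧ fccAdj j j₃ ∧ fccAdj j₂ j₃ := by
  decide

/-- In the cuboctahedron a neighbour `j` of `i` is adjacent to at most one other neighbour of `i`.
[folklore] -/
theorem fccTab_link_matching : ∀ i j k l : Fin 12, fccAdj i j → fccAdj i k → fccAdj i l → k ≠ l →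
    fccAdj j k → fccAdj j l → False := by
  decide

/-- An equatorial vertex of the anticuboctahedron has a neighbour adjacent to two other
neighbours. [folklore] -/
theorem hcpTab_equatorial_link : ∀ i : Fin 12, i.val < 6 → ∃ j k l : Fin 12,
    hcpAdj j i ∧ hcpAdj k i ∧ hcpAdj l i ∧ k ≠ l ∧ hcpAdj j k ∧ hcpAdj j l := by
  decide

/-- Both patterns are `4`-regular. [folklore] -/
theorem card_filter_hcpAdj (i : Fin 12) : (Finset.univ.filter fun j => hcpAdj j i).card = 4 := by
  revert i; decide

/-- Both patterns are `4`-regular. [folklore] -/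
theorem card_filter_fccAdj (i : Fin 12) : (Finset.univ.filter fun j => fccAdj j i).card = 4 := by
  revert i; decide

/-- The mirror symmetry `t ↦ t − (2ℓ/3)(1,1,1)` (`ℓ` the level) permutes `hcpTab`. [folklore] -/
theorem hcpTab_mirror : ∀ i : Fin 12, ∃ i' : Fin 12,
    (3 : ℤ) • hcpTab i' = (3 : ℤ) • hcpTab i - (2 * dotInt (hcpTab i) ![1, 1, 1]) • ![1, 1, 1] := by
  decide

/-- The mirror image of a lower-triangle point is an upper-triangle point. [folklore] -/
theorem hcpTab_mirror_bottom : ∀ i : Fin 12, 9 ≤ i.val → ∃ i' : Fin 12, 6 ≤ i'.val ∧ i'.val < 9 ∧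
    (3 : ℤ) • hcpTab i = (3 : ℤ) • hcpTab i' - (2 * dotInt (hcpTab i') ![1, 1, 1]) • ![1, 1, 1] := by
  decide

/-! ### Reference-point identities -/

/-- `refPt 18 (3t) = refPt 2 t` (`√18 = 3√2`). [folklore] -/
theorem refPt_eighteen_three_smul (t : Fin 3 → ℤ) : refPt 18 ((3 : ℤ) • t) = refPt 2 t := by
  rw [refPt_intSmul, refPt, refPt]
  push_cast
  rw [sqrt_eighteen_eq, smul_smul, smul_smul, smul_smul]
  congr 1
  have h2 : Real.sqrt 2 ≠ 0 := by positivity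
  field_simp

/-- The unit normal `n₀ = (1,1,1)/√3` of the mirror plane of the table has norm `1`. [folklore] -/
theorem norm_nzero : ‖(Real.sqrt 3)⁻¹ • (intVec ![1, 1, 1] : EuclideanSpace ℝ (Fin 3))‖ = 1 := by
  rw [norm_smul, norm_inv, Real.norm_of_nonneg (Real.sqrt_nonneg _), norm_intVec,
    show sqNormInt ![1, 1, 1] = 3 by decide]
  push_cast
  rw [inv_mul_cancel₀ (by positivity)]

/-- Inner product of a reference point with `n₀`: `2 ℓ / (√N √3)`, `ℓ` the level. [folklore] -/
theorem inner_refPt_nzero (N : ℕ) (t : Fin 3 → ℤ) :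
    ⟪refPt N t, (Real.sqrt 3)⁻¹ • (intVec ![1, 1, 1] : EuclideanSpace ℝ (Fin 3))⟫ =
      2 * ((Real.sqrt N)⁻¹ * (Real.sqrt 3)⁻¹) * (dotInt t ![1, 1, 1] : ℝ) := by
  simp only [refPt, real_inner_smul_left, real_inner_smul_right, inner_intVec]; ring

/-- `4/(√2 √3) = 𝗁` (both are positive with square `8/3`). [folklore] -/
theorem four_mul_inv_sqrt_two_mul_inv_sqrt_three :
    4 * ((Real.sqrt ((2 : ℕ) : ℝ))⁻¹ * (Real.sqrt 3)⁻¹) = layerSpacing := by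
  have h2 : (0 : ℝ) < Real.sqrt ((2 : ℕ) : ℝ) := by positivity
  have h3 : (0 : ℝ) < Real.sqrt 3 := by positivity
  have hl := layerSpacing_pos
  have hsq : (4 * ((Real.sqrt ((2 : ℕ) : ℝ))⁻¹ * (Real.sqrt 3)⁻¹)) ^ 2 = layerSpacing ^ 2 := by
    rw [layerSpacing_sq, mul_pow, mul_pow, inv_pow, inv_pow, Real.sq_sqrt (by positivity),
      Real.sq_sqrt (by positivity)]
    push_cast; norm_num
  have hpos : 0 < 4 * ((Real.sqrt ((2 : ℕ) : ℝ))⁻¹ * (Real.sqrt 3)⁻¹) := by positivity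
  nlinarith [hsq, hpos, hl]

/-- `12/(√18 √3) = 𝗁`. [folklore] -/
theorem twelve_mul_inv_sqrt_eighteen_mul_inv_sqrt_three :
    12 * ((Real.sqrt ((18 : ℕ) : ℝ))⁻¹ * (Real.sqrt 3)⁻¹) = layerSpacing := by
  rw [← four_mul_inv_sqrt_two_mul_inv_sqrt_three]
  push_cast
  rw [sqrt_eighteen_eq]
  have h2 : Real.sqrt 2 ≠ 0 := by positivity
  field_simp
  ring

/-- **Levels of the FCC reference points** against `n₀`: `0`, `𝗁` or `−𝗁`. [folklore] -/
theorem inner_fccRef_nzero (j : Fin 12) :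
    ⟪fccRef j, (Real.sqrt 3)⁻¹ • (intVec ![1, 1, 1] : EuclideanSpace ℝ (Fin 3))⟫ = 0 ∨
    ⟪fccRef j, (Real.sqrt 3)⁻¹ • (intVec ![1, 1, 1] : EuclideanSpace ℝ (Fin 3))⟫ = layerSpacing ∨
    ⟪fccRef j, (Real.sqrt 3)⁻¹ • (intVec ![1, 1, 1] : EuclideanSpace ℝ (Fin 3))⟫ = -layerSpacing := by
  rw [show fccRef j = refPt 2 (fccTab j) from rfl, inner_refPt_nzero, ← four_mul_inv_sqrt_two_mul_inv_sqrt_three]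
  rcases fccTab_level j with h | h | h <;> rw [h] <;> push_cast
  · left; ring
  · right; left; ring
  · right; right; ring

/-- The level of an upper-triangle HCP reference point is `𝗁`. [folklore] -/
theorem inner_hcpRef_nzero_top {i : Fin 12} (h6 : 6 ≤ i.val) (h9 : i.val < 9) :
    ⟪hcpRef i, (Real.sqrt 3)⁻¹ • (intVec ![1, 1, 1] : EuclideanSpace ℝ (Fin 3))⟫ = layerSpacing := by
  rw [show hcpRef i = refPt 18 (hcpTab i) from rfl, inner_refPt_nzero, hcpTab_level i, if_neg (by omega),
    if_pos h9, ← twelve_mul_inv_sqrt_eighteen_mul_inv_sqrt_three]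
  push_cast; ring

/-- The level of a lower-triangle HCP reference point is `−𝗁`. [folklore] -/
theorem inner_hcpRef_nzero_bottom {i : Fin 12} (h9 : 9 ≤ i.val) :
    ⟪hcpRef i, (Real.sqrt 3)⁻¹ • (intVec ![1, 1, 1] : EuclideanSpace ℝ (Fin 3))⟫ = -layerSpacing := by
  rw [show hcpRef i = refPt 18 (hcpTab i) from rfl, inner_refPt_nzero, hcpTab_level i, if_neg (by omega),
    if_neg (by omega), ← twelve_mul_inv_sqrt_eighteen_mul_inv_sqrt_three]
  push_cast; ring

/-! ### The mirror symmetry of the HCP reference configuration -/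

/-- The reflection in the plane `x + y + z = 0` on integer vectors: `t ↦ t − (2ℓ/3)(1,1,1)`. [folklore] -/
theorem mirror_intVec (t : Fin 3 → ℤ) :
    ((ℝ ∙ (intVec ![1, 1, 1] : EuclideanSpace ℝ (Fin 3)))ᗮ).reflection (intVec t) =
      intVec t - ((2 * dotInt t ![1, 1, 1] : ℝ) / 3) • intVec ![1, 1, 1] := by
  set v : EuclideanSpace ℝ (Fin 3) := intVec ![1, 1, 1] with hv
  set a : ℝ := (dotInt t ![1, 1, 1] : ℝ) / 3 with ha
  have hvv : ⟪v, v⟫ = 3 := by rw [hv, inner_intVec]; exact_mod_cast (by decide : dotInt ![1, 1, 1] ![1, 1, 1] = 3)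
  have htv : ⟪intVec t, v⟫ = (dotInt t ![1, 1, 1] : ℝ) := by rw [hv, inner_intVec]
  have hsplit : (intVec t : EuclideanSpace ℝ (Fin 3)) = (intVec t - a • v) + a • v := by abel
  have hperp : intVec t - a • v ∈ (ℝ ∙ v)ᗮ := by
    rw [Submodule.mem_orthogonal_singleton_iff_inner_left, inner_sub_left, real_inner_smul_left, htv, hvv, ha]
    ring
  rw [hsplit, map_add, map_smul, Submodule.reflection_mem_subspace_eq_self hperp,
    Submodule.reflection_orthogonalComplement_singleton_eq_neg, ha]
  module

/-- **The mirror symmetry permutes the HCP reference configuration.** [folklore] -/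
theorem mirror_hcpRef (i : Fin 12) : ∃ i' : Fin 12,
    ((ℝ ∙ (intVec ![1, 1, 1] : EuclideanSpace ℝ (Fin 3)))ᗮ).reflection (hcpRef i) = hcpRef i' := by
  obtain ⟨i', hi'⟩ := hcpTab_mirror i
  refine ⟨i', ?_⟩
  have key : ((3 : ℤ) : ℝ) • (intVec (hcpTab i') : EuclideanSpace ℝ (Fin 3)) =
      ((3 : ℤ) : ℝ) • intVec (hcpTab i) - ((2 * dotInt (hcpTab i) ![1, 1, 1] : ℤ) : ℝ) • intVec ![1, 1, 1] := by
    have h := congrArg intVec hi'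
    rwa [← intVec_sub, intVec_zsmul, intVec_zsmul, intVec_zsmul] at h
  rw [show hcpRef i = refPt 18 (hcpTab i) from rfl, show hcpRef i' = refPt 18 (hcpTab i') from rfl, refPt,
    refPt, map_smul, map_smul, mirror_intVec]
  congr 2
  have h3 : (intVec (hcpTab i') : EuclideanSpace ℝ (Fin 3)) =
      (1 / 3 : ℝ) • (((3 : ℤ) : ℝ) • intVec (hcpTab i) - ((2 * dotInt (hcpTab i) ![1, 1, 1] : ℤ) : ℝ) • intVec ![1, 1, 1]) := by
    rw [← key]; push_cast; module
  rw [h3]; push_cast; module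

/-- The mirror symmetry sends a lower-triangle reference point to an upper-triangle one. [folklore] -/
theorem mirror_hcpRef_bottom {i : Fin 12} (h9 : 9 ≤ i.val) : ∃ i' : Fin 12, 6 ≤ i'.val ∧ i'.val < 9 ∧
    ((ℝ ∙ (intVec ![1, 1, 1] : EuclideanSpace ℝ (Fin 3)))ᗮ).reflection (hcpRef i') = hcpRef i := by
  obtain ⟨i', h6, h9', hi'⟩ := hcpTab_mirror_bottom i h9
  refine ⟨i', h6, h9', ?_⟩
  have key : ((3 : ℤ) : ℝ) • (intVec (hcpTab i) : EuclideanSpace ℝ (Fin 3)) =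
      ((3 : ℤ) : ℝ) • intVec (hcpTab i') - ((2 * dotInt (hcpTab i') ![1, 1, 1] : ℤ) : ℝ) • intVec ![1, 1, 1] := by
    have h := congrArg intVec hi'
    rwa [← intVec_sub, intVec_zsmul, intVec_zsmul, intVec_zsmul] at h
  rw [show hcpRef i = refPt 18 (hcpTab i) from rfl, show hcpRef i' = refPt 18 (hcpTab i') from rfl, refPt,
    refPt, map_smul, map_smul, mirror_intVec]
  congr 2
  have h3 : (intVec (hcpTab i) : EuclideanSpace ℝ (Fin 3)) =
      (1 / 3 : ℝ) • (((3 : ℤ) : ℝ) • intVec (hcpTab i') - ((2 * dotInt (hcpTab i') ![1, 1, 1] : ℤ) : ℝ) • intVec ![1, 1, 1]) := by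
    rw [← key]; push_cast; module
  rw [h3]; push_cast; module

/-- **The range of a moved HCP reference configuration is unchanged by precomposing the mirror.**
[folklore] -/
theorem range_comp_mirror_hcpRef (A : EuclideanSpace ℝ (Fin 3) →ₗᵢ[ℝ] EuclideanSpace ℝ (Fin 3)) :
    Set.range (fun i => (A.comp
      ((ℝ ∙ (intVec ![1, 1, 1] : EuclideanSpace ℝ (Fin 3)))ᗮ).reflection.toLinearIsometry) (hcpRef i)) =
      Set.range (fun i => A (hcpRef i)) := by
  ext x
  simp only [Set.mem_range, LinearIsometry.coe_comp, Function.comp_apply,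
    LinearIsometryEquiv.coe_toLinearIsometry]
  constructor
  · rintro ⟨i, rfl⟩
    obtain ⟨i', hi'⟩ := mirror_hcpRef i
    exact ⟨i', by rw [hi']⟩
  · rintro ⟨i, rfl⟩
    obtain ⟨i', hi'⟩ := mirror_hcpRef i
    refine ⟨i', ?_⟩
    have : ((ℝ ∙ (intVec ![1, 1, 1] : EuclideanSpace ℝ (Fin 3)))ᗮ).reflection (hcpRef i') = hcpRef i := by
      rw [← hi', Submodule.reflection_reflection]
    rw [this]

/-- In a moved HCP reference configuration, `dist = 2` iff the table vectors are adjacent.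
[folklore] -/
theorem dist_map_hcpRef_eq_two_iff (A : EuclideanSpace ℝ (Fin 3) →ₗᵢ[ℝ] EuclideanSpace ℝ (Fin 3))
    (i j : Fin 12) : dist (A (hcpRef i)) (A (hcpRef j)) = 2 ↔ hcpAdj i j := by
  have h := dist_map_refPt_eq_two_iff (show (18 : ℕ) ≠ 0 by norm_num) (A := A) (hcpTab i) (hcpTab j)
  exact_mod_cast h

/-! ### Neighbour sets of a shared vertex -/

section Shared

variable {A C : EuclideanSpace ℝ (Fin 3) →ₗᵢ[ℝ] EuclideanSpace ℝ (Fin 3)}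

/-- **If the four `F`-neighbours of a common vertex `t` of `T = A(hcp)` and `F = C(fcc)` lie in
`T`, then the `T`-neighbours of `t` lie in `F`** (both neighbour sets have four elements).
[folklore] -/
theorem hcp_nbrs_subset_of_fcc_nbrs_subset {i₀ j₀ : Fin 12} (ht : A (hcpRef i₀) = C (fccRef j₀))
    (hlink : ∀ j : Fin 12, fccAdj j j₀ → C (fccRef j) ∈ Set.range (fun i => A (hcpRef i))) :
    ∀ i : Fin 12, hcpAdj i i₀ → A (hcpRef i) ∈ Set.range (fun j => C (fccRef j)) := by
  classical
  -- the two neighbour sets inside `range (A ∘ hcpRef)`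
  set NT : Set (EuclideanSpace ℝ (Fin 3)) := (fun i => A (hcpRef i)) '' {i | hcpAdj i i₀} with hNT
  set NF : Set (EuclideanSpace ℝ (Fin 3)) := (fun j => C (fccRef j)) '' {j | fccAdj j j₀} with hNF
  have hinjA : Function.Injective fun i : Fin 12 => A (hcpRef i) := fun i j h =>
    hcpTab_injective (refPt_injective (by norm_num) (A.injective h))
  have hinjC : Function.Injective fun j : Fin 12 => C (fccRef j) := fun i j h =>
    fccTab_injective (refPt_injective two_ne_zero (C.injective h))
  have hNFsub : NF ⊆ NT := by
    rintro _ ⟨j, hj, rfl⟩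
    obtain ⟨i, hi⟩ := hlink j hj
    refine ⟨i, ?_, hi⟩
    show hcpAdj i i₀
    rw [← dist_map_hcpRef_eq_two_iff A]
    dsimp only at hi
    rw [hi, ht]
    exact (dist_map_fccRef_eq_two_iff C j j₀).2 hj
  have hNTcard : NT.ncard ≤ 4 := by
    have hfin : ({i | hcpAdj i i₀} : Set (Fin 12)) = ↑(Finset.univ.filter fun i => hcpAdj i i₀) := by
      ext i; simp
    calc NT.ncard ≤ ({i | hcpAdj i i₀} : Set (Fin 12)).ncard := Set.ncard_image_le (Set.toFinite _)
      _ = 4 := by rw [hfin, Set.ncard_coe_finset, card_filter_hcpAdj]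
  have hNFcard : NF.ncard = 4 := by
    have hfin : ({j | fccAdj j j₀} : Set (Fin 12)) = ↑(Finset.univ.filter fun j => fccAdj j j₀) := by
      ext j; simp
    rw [hNF, Set.ncard_image_of_injective _ hinjC, hfin, Set.ncard_coe_finset, card_filter_fccAdj]
  have hNTfin : NT.Finite := (Set.toFinite _).image _
  have heq : NF = NT := Set.eq_of_subset_of_ncard_le hNFsub (by rw [hNFcard]; exact hNTcard) hNTfin
  intro i hi
  have : A (hcpRef i) ∈ NT := ⟨i, hi, rfl⟩
  rw [← heq] at this
  obtain ⟨j, -, hj⟩ := this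
  exact ⟨j, hj⟩

/-- **A shared vertex with shared link is not equatorial**: if `t = A(hcpRef i₀) = C(fccRef j₀)` and
the `F`-neighbours of `t` lie in `T`, then `i₀` is not on the hexagon of the table. [folklore] -/
theorem not_equatorial_of_fcc_nbrs_subset {i₀ j₀ : Fin 12} (ht : A (hcpRef i₀) = C (fccRef j₀))
    (hlink : ∀ j : Fin 12, fccAdj j j₀ → C (fccRef j) ∈ Set.range (fun i => A (hcpRef i))) :
    ¬ i₀.val < 6 := by
  intro h6
  have key := hcp_nbrs_subset_of_fcc_nbrs_subset ht hlink
  obtain ⟨j, k, l, hj, hk, hl, hkl, hjk, hjl⟩ := hcpTab_equatorial_link i₀ h6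
  obtain ⟨j', hj'⟩ := key j hj
  obtain ⟨k', hk'⟩ := key k hk
  obtain ⟨l', hl'⟩ := key l hl
  dsimp only at hj' hk' hl'
  -- transfer adjacencies to the cuboctahedron
  have adjC : ∀ {a b : Fin 12} {a' b' : Fin 12}, hcpAdj a b → C (fccRef a') = A (hcpRef a) →
      C (fccRef b') = A (hcpRef b) → fccAdj a' b' := by
    intro a b a' b' hab ha hb
    rw [← dist_map_fccRef_eq_two_iff C, ha, hb]
    exact (dist_map_hcpRef_eq_two_iff A a b).2 hab
  have hjj₀ : fccAdj j' j₀ := adjC hj hj' ht.symm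
  have hkj₀ : fccAdj k' j₀ := adjC hk hk' ht.symm
  have hlj₀ : fccAdj l' j₀ := adjC hl hl' ht.symm
  have hjk' : fccAdj j' k' := adjC hjk hj' hk'
  have hjl' : fccAdj j' l' := adjC hjl hj' hl'
  have hkl' : k' ≠ l' := by
    rintro rfl
    have hinjA : Function.Injective fun i : Fin 12 => A (hcpRef i) := fun i j h =>
      hcpTab_injective (refPt_injective (by norm_num) (A.injective h))
    exact hkl (hinjA (by dsimp only; rw [← hk', ← hl']))
  have sy : ∀ {a b : Fin 12}, fccAdj a b → fccAdj b a := by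
    intro a b h
    have := (dist_map_fccRef_eq_two_iff C a b).2 h
    rw [dist_comm] at this
    exact (dist_map_fccRef_eq_two_iff C b a).1 this
  exact fccTab_link_matching j₀ j' k' l' (sy hjj₀) (sy hkj₀) (sy hlj₀) hkl' hjk' hjl'

end Shared

/-! ### The far triple -/

/-- **The HCP shell against a cuboctahedron sharing a vertex star.**  Let `T` be HCP-arranged and
`F` FCC-arranged in `S²(2)`, let `t ∈ T ∩ F`, and let every `F`-neighbour of `t` (distance `2`) lie
in `T`.  Then there is a linear isometry `B` with `T = B(2 · hcpKissingPattern)` such that, for the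
unit normal `n = B n₀` of the mirror plane of `T` (`n₀ = (1,1,1)/√3`), `⟪t, n⟫ = 𝗁` and every point
of `T` either belongs to `F` or has level `⟪x, n⟫ = −𝗁` (the far triple, mirror image of the polar
triple containing `t`). [folklore] -/
theorem hcp_shell_far_triple {T F : Set (EuclideanSpace ℝ (Fin 3))}
    (hT : IsArrangedIn T hcpKissingPattern) (hF : IsArrangedIn F fccKissingPattern)
    {t : EuclideanSpace ℝ (Fin 3)} (htT : t ∈ T) (htF : t ∈ F)
    (hlink : ∀ f ∈ F, dist f t = 2 → f ∈ T) :
    ∃ B : EuclideanSpace ℝ (Fin 3) →ₗᵢ[ℝ] EuclideanSpace ℝ (Fin 3),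
      T = Set.range (fun i => B (hcpRef i)) ∧
      ⟪t, B ((Real.sqrt 3)⁻¹ • intVec ![1, 1, 1])⟫ = layerSpacing ∧
      ∀ x ∈ T, x ∈ F ∨ ⟪x, B ((Real.sqrt 3)⁻¹ • intVec ![1, 1, 1])⟫ = -layerSpacing := by
  obtain ⟨C, rfl⟩ := isArrangedIn_fcc_iff_range.1 hF
  obtain ⟨j₀, rfl⟩ := htF
  -- an isometry presenting `T` with the shared vertex NOT on the lower triangle
  obtain ⟨A, hA, i₀, hi₀, h9⟩ : ∃ A : EuclideanSpace ℝ (Fin 3) →ₗᵢ[ℝ] EuclideanSpace ℝ (Fin 3),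
      T = Set.range (fun i => A (hcpRef i)) ∧ ∃ i₀ : Fin 12, A (hcpRef i₀) = C (fccRef j₀) ∧ i₀.val < 9 := by
    obtain ⟨A₁, rfl⟩ := isArrangedIn_hcp_iff_range.1 hT
    obtain ⟨i₁, hi₁⟩ := htT
    by_cases h9 : i₁.val < 9
    · exact ⟨A₁, rfl, i₁, hi₁, h9⟩
    · obtain ⟨i', h6', h9', hi'⟩ := mirror_hcpRef_bottom (i := i₁) (by omega)
      refine ⟨A₁.comp ((ℝ ∙ (intVec ![1, 1, 1] : EuclideanSpace ℝ (Fin 3)))ᗮ).reflection.toLinearIsometry,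
        (range_comp_mirror_hcpRef A₁).symm, i', ?_, h9'⟩
      simp only [LinearIsometry.coe_comp, Function.comp_apply, LinearIsometryEquiv.coe_toLinearIsometry]
      rw [hi']; exact hi₁
  subst hA
  have hlink' : ∀ j : Fin 12, fccAdj j j₀ → C (fccRef j) ∈ Set.range (fun i => A (hcpRef i)) :=
    fun j hj => hlink _ ⟨j, rfl⟩ ((dist_map_fccRef_eq_two_iff C j j₀).2 hj)
  have hne : ¬ i₀.val < 6 := not_equatorial_of_fcc_nbrs_subset hi₀ hlink'
  have h6 : 6 ≤ i₀.val := by omega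
  -- `t` is an upper-triangle vertex: `hcpRef i₀ = fccRef j₁` with `j₁` of level `2`
  obtain ⟨j₁, hlev₁, hj₁⟩ := hcpTab_top_eq_three_smul i₀ h6 h9
  have ht₁ : hcpRef i₀ = fccRef j₁ := by
    show refPt 18 (hcpTab i₀) = refPt 2 (fccTab j₁); rw [hj₁, refPt_eighteen_three_smul]
  -- the cuboctahedron `F' = A(fcc)` shares a contact triangle with `F`, hence `F' = F`
  have key := hcp_nbrs_subset_of_fcc_nbrs_subset hi₀ hlink'
  obtain ⟨j₂, j₃, h₁₂, h₁₃, h₂₃⟩ := fccTab_exists_triangle j₁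
  have memT : ∀ {j : Fin 12}, fccAdj j₁ j → ∃ i : Fin 12, hcpAdj i i₀ ∧ A (hcpRef i) = A (fccRef j) := by
    intro j hj
    have hj' : fccAdj j j₁ := by
      have := (dist_map_fccRef_eq_two_iff A j₁ j).2 hj
      rw [dist_comm] at this
      exact (dist_map_fccRef_eq_two_iff A j j₁).1 this
    obtain ⟨i, hi⟩ := fccTab_adj_top j₁ j hlev₁ hj'
    have e : hcpRef i = fccRef j := by
      show refPt 18 (hcpTab i) = refPt 2 (fccTab j); rw [hi, refPt_eighteen_three_smul]
    refine ⟨i, ?_, by rw [e]⟩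
    rw [← dist_map_hcpRef_eq_two_iff A, e, ht₁]
    exact (dist_map_fccRef_eq_two_iff A j j₁).2 hj'
  have memF : ∀ {j : Fin 12}, fccAdj j₁ j → A (fccRef j) ∈ Set.range (fun j => C (fccRef j)) := by
    intro j hj
    obtain ⟨i, hi, he⟩ := memT hj
    rw [← he]; exact key i hi
  have hFF : Set.range (fun j => A (fccRef j)) = Set.range (fun j => C (fccRef j)) := by
    refine eq_of_isArrangedIn_fcc_of_triangle (isArrangedIn_fcc_iff_range.2 ⟨A, rfl⟩)
      (isArrangedIn_fcc_iff_range.2 ⟨C, rfl⟩) ⟨j₁, rfl⟩ ⟨j₂, rfl⟩ ⟨j₃, rfl⟩ ?_ (memF h₁₂) (memF h₁₃)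
      ((dist_map_fccRef_eq_two_iff A j₁ j₂).2 h₁₂) ((dist_map_fccRef_eq_two_iff A j₁ j₃).2 h₁₃)
      ((dist_map_fccRef_eq_two_iff A j₂ j₃).2 h₂₃)
    exact ⟨j₀, by dsimp only; rw [← hi₀, ht₁]⟩
  refine ⟨A, rfl, ?_, ?_⟩
  · dsimp only
    rw [← hi₀, A.inner_map_map]; exact inner_hcpRef_nzero_top h6 h9
  · rintro _ ⟨i, rfl⟩
    by_cases hi9 : i.val < 9
    · left
      obtain ⟨j, hj⟩ := hcpTab_eq_three_smul i hi9
      have e : hcpRef i = fccRef j := by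
        show refPt 18 (hcpTab i) = refPt 2 (fccTab j); rw [hj, refPt_eighteen_three_smul]
      rw [← hFF]; exact ⟨j, by dsimp only; rw [e]⟩
    · right
      rw [A.inner_map_map]; exact inner_hcpRef_nzero_bottom (by omega)

end Summit.AtomisticToContinuum.Crystallization.Theorems

end
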